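import Mathlib.Analysis.SpecialFunctions.Pow.Asymptotics
import Summits.ABC.IUTFork.Repair.RHReqsideWeightLaws
import Summits.ABC.IUTFork.Repair.RHHeightScalingBarrier
import HarnessLib

/-!
# ROUND-3 AXIS D2, class «κ′ WEIGHT LAWS» — kernel face for RULING R84 (c): the LABEL-1 PILOT CREDIT of a law with `f(1) < den`
# («affine ½» = `lawAffine 1`, `den = 2`): its `l`-only size `c₀ = (den − f(1))/dS⁺_f(l⋆)`, exponent `0`, NON-closing

abc-iut cell, rung LADDER-ABC:A2.RESCUE.H; seat abc-iut-rh2-w-1 g4 (KEY D2-EXP-6 follow-up; abc-iut-rh-lead g5 RULING R84 (c) 2026-08-27T13:01:10Z «rh2-w-1 to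
confirm or correct c₀ = 1/80 at l = 13, 1.96·10⁻⁵ at l = 107»; abc-iut-rh3-tst-1 13:03:15Z addendum (B)); companion of `RHReqsideWeightLawsHeightScaling`
(p533167) whose door sentence is scoped «`f(1) ≥ den`». PROOF-ONLY: no `def`, nothing re-typed.
THE MEMBER. In abc-iut-reqb-typ-1's k1-cell `ReqsideWeightLaws.Cell f den e m δ r_in r_out j` (p506542; ledger form `(f(j) − den)·m ≤ den(jδ + (j+1)G) + ρ_j`)
the catalogued law «affine ½» is `f = lawAffine 1 = (j ↦ j²)` with `den = 2`: label `1` has demand `f(1) − den = −1` (a CREDIT `m/den = m_q/2`, the halved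
`q`-pilot, k5-type), every label `j ≥ 2` has demand `j² − 2 ≥ 2`. Hence the positive-part demand sum is
`dS⁺(n) := Σ_{j≤n}(f(j) − den)⁺ = demandSum (lawAffine 1) 2 n + 1 = S(n) − (n − 1) = (n−1)(2n²+5n−6)/6` (`S(n) = Σ_{j≤n}(j²−1)`, `n = l⋆ = (l−1)/2`), and the
height-free gross-currency fraction carried by the label-1 credit is `c₀(l) = (den − f(1))/dS⁺(l⋆) = 6/((n−1)(2n²+5n−6))`:
`l = 11: 1/46` · `l = 13: 1/80` · `l = 17: 1/189` · `l = 107: 1/50 934 = 1.9633·10⁻⁵` — R84 (c)'s two numbers CONFIRMED (§1, integer side, by name).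
§2 reads the credit in abc-iut-rh2-w-2's height-ray vocabulary (p531802 `HeightScalingBarrier`: `PowerBoundFrom`, `requirement M₁ tol s = M₁s − tol`, `ClosedBy`,
`recoveredFraction`, `NeverClosedFrom`): per place the credit is `(den − f(1))·m_q·s/den` and the gross requirement `dS⁺·m_q·s/den`, both `∝ Σ_w u_w m_w·s/den`
over a datum, so WLOG `c = den − f(1) = 1`, `M₁ = dS⁺(l⋆)`. The one-object family `s ↦ c·s` has MASS exponent `1` (`PowerBoundFrom _ 1 c s₁`) — recovered-
fraction exponent `0`, OUTSIDE `Barrier`'s antecedent `a < 1` (and provably under no power bound of exponent `< 1`); its recovered fraction at `tol = 0` is the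
height-free constant `c/M₁` at EVERY dilation; any family whose supplied mass is `≤ A + c·s` (conductor-type tiers `A` plus the pilot credit) with `c < M₁` is
NOT closed at any `s > (A + tol)/(M₁ − c)` — abc-iut-rh2-w-2's `not_closedBy_of_heightFree` is the case `c = 0`. Instances: fraction `1/80` (`l = 13`) and
`1/50 934` (`l = 107`) at every `s ≠ 0`, `NeverClosedFrom … 0 1`. R84 wording: «DoorAt, non-closing» (constant printed; closing needs fraction `1`).
HONEST FRAMING: integer/real arithmetic about OUR typed k1-cell under a HYPOTHETICAL parameter setting (REQB framing — not a claim that [EtTh]/[IUTchI–III]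
admit any pilot law other than `j²`); nothing here asserts that abc is proved or refuted, or that [IUTchIII] Cor. 3.12 / [IUTchIV] Thm. 1.10 holds or fails at
any datum, or takes a side on any author; typed ≠ proved; computed ≠ proved. [claim: Mochizuki2012, status: disputed] for every IUT locution.
[cite: Mochizuki2012, IUTchIII Cor. 3.12 p. 173–174; IUTchIV Prop. 1.4 p. 13, Thm. 1.10 Step (v) p. 27–29]
-/

open Finset Filter

namespace Summit.ABC.IUTFork.Repair.RH.ReqsideWeightLaws.LabelOneCredit

open Summit.ABC.IUTFork.Repair.RH.ReqsideWeightLaws Summit.ABC.IUTFork.Repair.RH.HeightScalingBarrier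

/-! ## §1. Integer side: the label-1 credit of «affine ½» and the positive-part demand sum `dS⁺` in closed form -/

/-- `lawAffine 1` IS the print numerator `j²` (the law differs from print only through `den = 2`). [folklore] -/
theorem lawAffine_one_eq_sq (j : ℕ) : lawAffine 1 j = (j : ℤ) ^ 2 := by
  unfold lawAffine; push_cast; ring

/-- Label `1`: `f(1) − den = −1 < 0` — a CREDIT of one unit of `m/den` (the halved `q`-pilot), so `den − f(1) = 1`. [folklore] -/
theorem demand_at_one : lawAffine 1 1 - 2 = -1 := by
  rw [lawAffine_one_eq_sq]; norm_num

/-- Every label `j ≥ 2` is in DEMAND by at least `2` units: `j² − 2 ≥ 2` — label `1` is the ONLY credit label. [folklore] -/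
theorem two_le_demand {j : ℕ} (hj : 2 ≤ j) : 2 ≤ lawAffine 1 j - 2 := by
  rw [lawAffine_one_eq_sq]
  have hj' : (2 : ℤ) ≤ j := by exact_mod_cast hj
  nlinarith

/-- **THE PILOT CREDIT LICENSES LABEL `1` AT EVERY HEIGHT**: under `lawAffine 1 / den 2`, label `1` is a k1-cell for EVERY order `m ≥ 0` — i.e. at every
height multiple `s·m_q` (`δ ≥ 0`, `r_out ≤ r_in`): `−m ≤ 0 ≤ den(δ + 2G)`. This is the exponent-`0` member of the class. [folklore] -/
theorem cell_at_one_every_order {e m δ rin rout : ℤ} (he : 0 < e) (hm : 0 ≤ m) (hδ : 0 ≤ δ) (hG : rout ≤ rin) :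
    Cell (lawAffine 1) 2 e m δ rin rout 1 := by
  refine cell_of_linear (by norm_num) he ?_
  rw [demand_at_one]
  push_cast
  nlinarith

/-- **CLOSED FORM of the positive-part demand sum**: `6·dS⁺(n) = 6·(demandSum (lawAffine 1) 2 n + 1) = (n−1)(2n²+5n−6)` (adding back the single
credit unit of label `1`; from p506542 `six_mul_demandSum_affine`). [folklore] -/
theorem six_mul_demandSumPos (n : ℕ) :
    6 * (demandSum (lawAffine 1) 2 n + 1) = ((n : ℤ) - 1) * (2 * (n : ℤ) ^ 2 + 5 * n - 6) := by
  have h := six_mul_demandSum_affine 1 2 n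
  push_cast at h
  linear_combination h

/-- **`dS⁺(n) = S(n) − (n−1)`**: the gross requirement of «affine ½» is print's demand sum `S(n) = Σ_{j≤n}(j²−1)` minus one unit per label `≥ 2`. [folklore] -/
theorem demandSumPos_eq_print_sub (n : ℕ) :
    demandSum (lawAffine 1) 2 n + 1 = demandSum (fun j => (j : ℤ) ^ 2) 1 n - ((n : ℤ) - 1) := by
  have h1 := six_mul_demandSumPos n
  have h2 := six_mul_demandSum_sq n
  have h : (6 : ℤ) * (demandSum (lawAffine 1) 2 n + 1) = 6 * (demandSum (fun j => (j : ℤ) ^ 2) 1 n - ((n : ℤ) - 1)) := by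
    linear_combination h1 - h2
  exact mul_left_cancel₀ (by norm_num : (6 : ℤ) ≠ 0) h

/-- `l = 11` (`n = 5`): `dS⁺ = 46` (abc-iut-rh3-tst-1's `1/46`). [folklore] -/
theorem demandSumPos_five : demandSum (lawAffine 1) 2 5 + 1 = 46 := by
  have h := six_mul_demandSumPos 5; push_cast at h; omega

/-- **`l = 13` (`n = 6`): `dS⁺ = 80` — R84 (c)'s `c₀ = 1/80`.** [folklore] -/
theorem demandSumPos_six : demandSum (lawAffine 1) 2 6 + 1 = 80 := by
  have h := six_mul_demandSumPos 6; push_cast at h; omega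

/-- `l = 17` (`n = 8`): `dS⁺ = 189` (abc-iut-rh3-tst-1's `1/189`). [folklore] -/
theorem demandSumPos_eight : demandSum (lawAffine 1) 2 8 + 1 = 189 := by
  have h := six_mul_demandSumPos 8; push_cast at h; omega

/-- **`l = 107` (`n = 53`): `dS⁺ = 50 934` — R84 (c)'s `c₀ = 1/50 934 = 1.9633·10⁻⁵`.** [folklore] -/
theorem demandSumPos_fiftyThree : demandSum (lawAffine 1) 2 53 + 1 = 50934 := by
  have h := six_mul_demandSumPos 53; push_cast at h; omega

/-- The decimal of record: `1.96·10⁻⁵ < 1/50 934 < 1.97·10⁻⁵`. [folklore] -/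
theorem inv_fiftyThree_decimal : (1.96e-5 : ℝ) < 1 / 50934 ∧ (1 : ℝ) / 50934 < 1.97e-5 := by
  constructor <;> norm_num

/-- **NON-CLOSING for every `l ≥ 5`**: `dS⁺(n) ≥ 2` once `n ≥ 2`, i.e. `c₀ = 1/dS⁺ ≤ 1/2 < 1` (closing needs fraction `1`). [folklore] -/
theorem two_le_demandSumPos {n : ℕ} (hn : 2 ≤ n) : 2 ≤ demandSum (lawAffine 1) 2 n + 1 := by
  have h := six_mul_demandSumPos n
  have hn' : (2 : ℤ) ≤ n := by exact_mod_cast hn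
  nlinarith [mul_nonneg (sub_nonneg.mpr hn') (sub_nonneg.mpr hn')]

/-- `dS⁺` is at least cubic: `6·dS⁺(n) ≥ (n−1)·2n²` for `n ≥ 2`, so `c₀(l) ≤ 3/((l⋆−1)·l⋆²) → 0` in `l` (height-free, `l`-only). [folklore] -/
theorem cube_le_six_mul_demandSumPos {n : ℕ} (hn : 2 ≤ n) :
    ((n : ℤ) - 1) * (2 * (n : ℤ) ^ 2) ≤ 6 * (demandSum (lawAffine 1) 2 n + 1) := by
  rw [six_mul_demandSumPos]
  have hn' : (2 : ℤ) ≤ n := by exact_mod_cast hn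
  nlinarith [mul_nonneg (sub_nonneg.mpr hn') (sub_nonneg.mpr hn')]

/-! ## §2. The credit on the height ray, BY NAME in `HeightScalingBarrier`'s vocabulary: exponent `0`, constant `c/M₁`, never closing -/

/-- **Mass exponent `1`** (recovered-fraction exponent `0`): the linear credit `s ↦ c·s` obeys `PowerBoundFrom _ 1 c s₁` — door-SHAPED. [folklore] -/
theorem linear_powerBoundFrom (c s₁ : ℝ) : PowerBoundFrom (fun s => c * s) 1 c s₁ := by
  intro s _
  rw [Real.rpow_one]

/-- … and for `c > 0` it obeys NO power bound of exponent `a < 1` from any onset: the member sits OUTSIDE `Barrier`'s antecedent — the barrier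
excludes it correctly rather than missing it (abc-iut-rh3-tst-1 (B)). [folklore] -/
theorem not_powerBoundFrom_linear_of_lt_one {c a C s₁ : ℝ} (hc : 0 < c) (ha : a < 1) :
    ¬ PowerBoundFrom (fun s => c * s) a C s₁ := by
  intro h
  have ht : Tendsto (fun s : ℝ => C * s ^ (-(1 - a))) atTop (nhds (C * 0)) :=
    (tendsto_rpow_neg_atTop (by linarith : 0 < 1 - a)).const_mul C
  rw [mul_zero] at ht
  have hev : ∀ᶠ s : ℝ in atTop, C * s ^ (-(1 - a)) < c := ht.eventually (gt_mem_nhds hc)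
  obtain ⟨s, hs1, hs2⟩ := (hev.and (eventually_ge_atTop (max s₁ 1))).exists
  have hs₁ : s₁ ≤ s := le_trans (le_max_left _ _) hs2
  have hs0 : 0 < s := lt_of_lt_of_le zero_lt_one (le_trans (le_max_right _ _) hs2)
  have hb := h s hs₁
  have hsplit : C * s ^ a = C * s ^ (-(1 - a)) * s := by
    have : s ^ a = s ^ (-(1 - a)) * s := by
      rw [show a = -(1 - a) + 1 by ring, Real.rpow_add_one hs0.ne']
      ring_nf
    rw [this]; ring
  have hlt : C * s ^ (-(1 - a)) * s < c * s := mul_lt_mul_of_pos_right hs1 hs0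
  simp only at hb
  linarith

/-- **EXPONENT `0` EXACTLY, CONSTANT `c/M₁`**: at `tol = 0` the one-object family `s ↦ c·s` recovers the HEIGHT-FREE fraction `c/M₁` of the requirement
`M₁·s` at every dilation `s ≠ 0` — for the «affine ½» member `c/M₁ = (den − f(1))/dS⁺(l⋆) = c₀(l)`. [folklore] -/
theorem recoveredFraction_linear (c M₁ : ℝ) {s : ℝ} (hs : s ≠ 0) :
    recoveredFraction (fun _ : Fin 1 => fun s => c * s) M₁ 0 s = c / M₁ := by
  unfold recoveredFraction suppliedMass requirement
  simp only [Finset.sum_const, Finset.card_univ, Fintype.card_fin, nsmul_eq_mul, Nat.cast_one, one_mul, sub_zero]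
  rw [mul_div_mul_right _ _ hs]

/-- **FLOOR AT EVERY DILATION** (abc-iut-rh3-tst-1's «`C/R ≥ c_f` for every `s`»): any family whose supplied mass dominates a linear credit `c·s`
(`c ≥ 0`) recovers at least the fraction `c/M₁` wherever the requirement is positive (`tol ≥ 0`). [folklore] -/
theorem div_le_recoveredFraction_of_linear_le {k : ℕ} {f : Fin k → ℝ → ℝ} {c M₁ tol s : ℝ} (hM : 0 < M₁) (hc : 0 ≤ c)
    (htol : 0 ≤ tol) (hT : 0 < requirement M₁ tol s) (hf : c * s ≤ suppliedMass f s) :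
    c / M₁ ≤ recoveredFraction f M₁ tol s := by
  unfold recoveredFraction
  unfold requirement at hT ⊢
  rw [div_le_div_iff₀ hM hT]
  have h1 : c * (M₁ * s - tol) ≤ c * (M₁ * s) := by nlinarith
  have h2 : c * (M₁ * s) = c * s * M₁ := by ring
  have h3 : c * s * M₁ ≤ suppliedMass f s * M₁ := mul_le_mul_of_nonneg_right hf hM.le
  linarith

/-- **NEVER CLOSING PAST AN EXPLICIT DILATION**: if a family's supplied mass is at most `A + c·s` from `s₁` on (height-free tiers `A` — conductor-type,
abc-iut-rh2-w-2's case `c = 0` — plus a linear pilot credit of slope `c`) and `c < M₁`, then it does NOT close the requirement `M₁s − tol` at any `s ≥ s₁`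
with `s > (A + tol)/(M₁ − c)`. [folklore] -/
theorem not_closedBy_of_affine_bound {k : ℕ} {f : Fin k → ℝ → ℝ} {A c M₁ tol s₁ s : ℝ} (hcM : c < M₁)
    (hf : ∀ s', s₁ ≤ s' → suppliedMass f s' ≤ A + c * s') (hs₁ : s₁ ≤ s) (hs : (A + tol) / (M₁ - c) < s) :
    ¬ ClosedBy f M₁ tol s := by
  intro h
  have hb := le_trans h (hf s hs₁)
  unfold requirement at hb
  have hpos : 0 < M₁ - c := sub_pos.mpr hcM
  have hlt : A + tol < (M₁ - c) * s := by
    have := (div_lt_iff₀ hpos).mp hs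
    linarith
  nlinarith

/-- The same as `NeverClosedFrom` with the explicit onset `max s₁ ((A + tol)/(M₁ − c) + 1)`. [folklore] -/
theorem neverClosedFrom_of_affine_bound {k : ℕ} {f : Fin k → ℝ → ℝ} {A c M₁ tol s₁ : ℝ} (hcM : c < M₁)
    (hf : ∀ s', s₁ ≤ s' → suppliedMass f s' ≤ A + c * s') :
    NeverClosedFrom f M₁ tol (max s₁ ((A + tol) / (M₁ - c) + 1)) := fun _ hs =>
  not_closedBy_of_affine_bound hcM hf (le_trans (le_max_left _ _) hs)
    (by linarith [le_trans (le_max_right _ _) hs])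

/-- The bare pilot credit (`A = 0`): `s ↦ c·s` with `c < M₁` never closes `M₁s − tol` from `tol/(M₁ − c) + 1` on; at `tol = 0` from every `s₀ > 0`. [folklore] -/
theorem neverClosedFrom_linear {c M₁ tol : ℝ} (hcM : c < M₁) :
    NeverClosedFrom (fun _ : Fin 1 => fun s => c * s) M₁ tol (tol / (M₁ - c) + 1) := by
  intro s hs
  have hs' : tol / (M₁ - c) < s := lt_of_lt_of_le (lt_add_one _) hs
  refine not_closedBy_of_affine_bound (A := 0) (s₁ := s) hcM (fun s' _ => ?_) le_rfl (by simpa using hs')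
  unfold suppliedMass
  simp

/-- `tol = 0`: never closed from any positive onset. [folklore] -/
theorem neverClosedFrom_linear_zero_tol {c M₁ s₀ : ℝ} (hcM : c < M₁) (hs₀ : 0 < s₀) :
    NeverClosedFrom (fun _ : Fin 1 => fun s => c * s) M₁ 0 s₀ := by
  intro s hs
  refine not_closedBy_of_affine_bound (A := 0) (s₁ := s) hcM (fun s' _ => ?_) le_rfl ?_
  · unfold suppliedMass; simp
  · simp; linarith

/-! ## §3. R84 (c)'s two instances: `l = 13` and `l = 107` (units `m_q·s/den`, summed over places with the weights `u_w`: `c = den − f(1) = 1`, `M₁ = dS⁺`) -/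

/-- **`l = 13`: fraction `1/80` at every dilation** — `M₁ = dS⁺(6)` taken BY NAME from §1. [folklore] -/
theorem fraction_l13 {s : ℝ} (hs : s ≠ 0) :
    recoveredFraction (fun _ : Fin 1 => fun s => (1 : ℝ) * s) ((demandSum (lawAffine 1) 2 6 + 1 : ℤ) : ℝ) 0 s = 1 / 80 := by
  rw [demandSumPos_six, recoveredFraction_linear _ _ hs]; norm_num

/-- **`l = 107`: fraction `1/50 934` at every dilation** — `M₁ = dS⁺(53)` BY NAME. [folklore] -/
theorem fraction_l107 {s : ℝ} (hs : s ≠ 0) :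
    recoveredFraction (fun _ : Fin 1 => fun s => (1 : ℝ) * s) ((demandSum (lawAffine 1) 2 53 + 1 : ℤ) : ℝ) 0 s = 1 / 50934 := by
  rw [demandSumPos_fiftyThree, recoveredFraction_linear _ _ hs]; norm_num

/-- `l = 13`: the credit alone never closes the gross requirement `80·s` from `s₀ = 1` on (`tol = 0`). [folklore] -/
theorem neverClosed_l13 : NeverClosedFrom (fun _ : Fin 1 => fun s => (1 : ℝ) * s) 80 0 1 :=
  neverClosedFrom_linear_zero_tol (by norm_num) one_pos

/-- `l = 107`: the credit alone never closes `50 934·s` from `s₀ = 1` on (`tol = 0`). [folklore] -/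
theorem neverClosed_l107 : NeverClosedFrom (fun _ : Fin 1 => fun s => (1 : ℝ) * s) 50934 0 1 :=
  neverClosedFrom_linear_zero_tol (by norm_num) one_pos

end Summit.ABC.IUTFork.Repair.RH.ReqsideWeightLaws.LabelOneCredit
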